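import Summits.ValiantsHypothesis.ValiantsHypothesis.Theorems.BarrierLeverAnchoredDoorHitsLowerPairsStarSpec
import Summits.ValiantsHypothesis.ValiantsHypothesis.Theorems.BarrierLeverAnchoredDoorHitsLowerPairsBase

/-!
# Support item `AnchoredDoorHitsLowerPairs` (stmt-ValiantsHypothesis-22510), line `anchored-peeling`:
# THIN VERTEX STEP, part 1 — killing variables in the symbolic anchored witness

Helper file towards the registered open stub `stub_vertexStep` of the skeleton
`Cruxes/AnchoredDoorHitsLowerPairs/Lines/anchored_peeling.lean` (v5; planner valiant-natproofs-p1 g19, D-0145; lane val-np-p2).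
Cell valiant-natproofs, rung V4, 𝒟-side door (c); prover seat val-np-p2 gen 11. Closes NO item (`--supports stmt-ValiantsHypothesis-22510`).

Generic tool: the algebra map `killVars V` of a multivariate polynomial ring that sends the variables in `V` to `0` and fixes the
others (`coeff_killVars`: the coefficient of `m` survives iff `m` avoids `V`). Applied to the symbolic anchored witness
(`symbFactor`, `symbolicWitness` of `…StarSpec` / `…Defs`):
* `killVars_symbFactor_of_mem` — killing an `x`-variable of the anchor's `x`-part kills the whole factor (it becomes `1`);
* `killVars_symbFactor_castAdd_of_not_mem` — killing `x_a` for `a ∉ A` only removes the twist `1 + φ_{α a} x_a`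
  (the result is the explicit `x_a`-free factor `delFactor a α`);
* `coeff_symbolicWitness_xfree` — the symbolic witness has NO non-constant `x`-free monomials:
  `[y^W] symbolicWitness s h = [W = ∅]` (every anchor has a nonempty `x`-part).
These feed the THIN VERTEX STEP (parts 2–4): the `T`-specialised witness factors as «`x_a`-free part» × «designed `a`-anchors».

WHAT THIS IS NOT: bookkeeping only; nothing on items 22510 / 19717 themselves, on crux stmt-ValiantsHypothesis-14610, or on `VP` versus `VNP`.
-/

set_option linter.dupNamespace false

namespace Summit.ValiantsHypothesis.ValiantsHypothesis.Theorems.BarrierLever.AnchoredPeeling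

open Finset MvPolynomial
open Summit.ValiantsHypothesis.ValiantsHypothesis.Theorems.BarrierLever.BrickCalculus
  (pexpo pexpo_def pexpo_le_iff pexpo_sub pexpo_apply_castAdd pexpo_apply_natAdd)
open Summit.ValiantsHypothesis.ValiantsHypothesis.Theorems.BarrierLever.ProductStateSums (castAdd_ne_natAdd)

noncomputable section

namespace ThinStep

/-! ## 1. Killing a set of variables -/

section Kill

variable {σ : Type*} {R : Type*} [CommSemiring R] [DecidableEq σ]

/-- The `R`-algebra map killing the variables in `V` (`X v ↦ 0` for `v ∈ V`, `X v ↦ X v` otherwise). -/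
def killVars (V : Finset σ) : MvPolynomial σ R →ₐ[R] MvPolynomial σ R :=
  bind₁ fun v => if v ∈ V then 0 else X v

/-- `killVars` on a variable. -/
theorem killVars_X (V : Finset σ) (v : σ) :
    killVars V (X v : MvPolynomial σ R) = if v ∈ V then 0 else X v := by
  rw [killVars, bind₁_X_right]

/-- `killVars` on a constant. -/
theorem killVars_C (V : Finset σ) (r : R) : killVars V (C r : MvPolynomial σ R) = C r := by
  rw [killVars, bind₁_C_right]

/-- `killVars` on a monomial: kept iff its support avoids `V`. -/
theorem killVars_monomial (V : Finset σ) (d : σ →₀ ℕ) (r : R) :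
    killVars V (monomial d r) = if Disjoint d.support V then monomial d r else 0 := by
  rw [killVars, bind₁_monomial]
  by_cases hd : Disjoint d.support V
  · rw [if_pos hd, monomial_eq, Finsupp.prod]
    congr 1
    exact Finset.prod_congr rfl (fun i hi => by rw [if_neg (Finset.disjoint_left.mp hd hi)])
  · rw [if_neg hd]
    obtain ⟨i, hi, hiV⟩ := Finset.not_disjoint_iff.mp hd
    rw [Finset.prod_eq_zero hi, mul_zero]
    rw [if_pos hiV, zero_pow (Finsupp.mem_support_iff.mp hi)]

/-- **Coefficients after killing**: monomials avoiding `V` keep their coefficient, the others vanish. -/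
theorem coeff_killVars (V : Finset σ) (f : MvPolynomial σ R) (m : σ →₀ ℕ) :
    coeff m (killVars V f) = if Disjoint m.support V then coeff m f else 0 := by
  conv_lhs => rw [f.as_sum, map_sum, coeff_sum]
  simp_rw [killVars_monomial]
  have hterm : ∀ d ∈ f.support, coeff m (if Disjoint d.support V then monomial d (coeff d f) else 0) =
      if d = m then (if Disjoint m.support V then coeff m f else 0) else 0 := by
    intro d _
    by_cases hdm : d = m
    · subst hdm
      by_cases hV : Disjoint d.support V
      · rw [if_pos hV, if_pos rfl, if_pos hV, coeff_monomial, if_pos rfl]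
      · rw [if_neg hV, if_pos rfl, if_neg hV, coeff_zero]
    · rw [if_neg hdm]
      by_cases hV : Disjoint d.support V
      · rw [if_pos hV, coeff_monomial, if_neg hdm]
      · rw [if_neg hV, coeff_zero]
  rw [Finset.sum_congr rfl hterm, Finset.sum_ite_eq' f.support m]
  by_cases hm : m ∈ f.support
  · rw [if_pos hm]
  · rw [if_neg hm]
    by_cases hV : Disjoint m.support V
    · rw [if_pos hV, notMem_support_iff.mp hm]
    · rw [if_neg hV]

/-- Killed coefficients vanish. -/
theorem coeff_killVars_of_not_disjoint (V : Finset σ) (f : MvPolynomial σ R) {m : σ →₀ ℕ}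
    (hm : ¬ Disjoint m.support V) : coeff m (killVars V f) = 0 := by
  rw [coeff_killVars, if_neg hm]

/-- Surviving coefficients are unchanged. -/
theorem coeff_killVars_of_disjoint (V : Finset σ) (f : MvPolynomial σ R) {m : σ →₀ ℕ}
    (hm : Disjoint m.support V) : coeff m (killVars V f) = coeff m f := by
  rw [coeff_killVars, if_pos hm]

end Kill

/-! ## 2. Killing `x`-variables in the anchor factors -/

variable {h : ℕ}

/-- The `x_a`-free anchor factor: `symbFactor h α` with the twist `1 + φ_{α a} x_a` removed (`a ∉ A`). -/
def delFactor (a : Fin h) (α : Finset (Fin h) × Finset (Fin h)) :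
    MvPolynomial (Fin (h + h)) (MvPolynomial (Param h) ℂ) :=
  1 + C (X (Sum.inl α)) * (∏ b ∈ α.1, X (Fin.castAdd h b)) * (∏ c ∈ α.2, X (Fin.natAdd h c)) *
    (∏ b ∈ (univ \ α.1).erase a, (1 + C (X (Sum.inr (Sum.inl (α, b)))) * X (Fin.castAdd h b))) *
    (∏ d ∈ univ \ α.2, (1 + C (X (Sum.inr (Sum.inr (α, d)))) * X (Fin.natAdd h d)))

/-- **Killing an `x`-variable of the `x`-part kills the factor.** -/
theorem killVars_symbFactor_of_mem (V : Finset (Fin (h + h))) (α : Finset (Fin h) × Finset (Fin h)) {b : Fin h}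
    (hb : b ∈ α.1) (hV : Fin.castAdd h b ∈ V) :
    killVars V (symbFactor h α) = 1 := by
  classical
  have hzero : killVars V (∏ b ∈ α.1, X (Fin.castAdd h b) :
      MvPolynomial (Fin (h + h)) (MvPolynomial (Param h) ℂ)) = 0 := by
    rw [map_prod]
    exact Finset.prod_eq_zero hb (by rw [killVars_X, if_pos hV])
  rw [symbFactor, map_add, map_one, map_mul, map_mul, map_mul, map_mul, hzero]
  simp only [mul_zero, zero_mul, add_zero]

/-- **Killing `x_a` for `a ∉ A` removes exactly the twist at `a`.** -/
theorem killVars_symbFactor_castAdd_of_not_mem (a : Fin h) (α : Finset (Fin h) × Finset (Fin h)) (ha : a ∉ α.1) :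
    killVars {Fin.castAdd h a} (symbFactor h α) = delFactor a α := by
  classical
  have hX : ∀ b : Fin h, killVars {Fin.castAdd h a} (X (Fin.castAdd h b) :
        MvPolynomial (Fin (h + h)) (MvPolynomial (Param h) ℂ)) = if b = a then 0 else X (Fin.castAdd h b) := by
    intro b
    rw [killVars_X]
    by_cases hba : b = a
    · rw [if_pos (Finset.mem_singleton.mpr (by rw [hba])), if_pos hba]
    · rw [if_neg (fun hm => hba (Fin.castAdd_injective _ _ (Finset.mem_singleton.mp hm))), if_neg hba]
  have hY : ∀ c : Fin h, killVars {Fin.castAdd h a} (X (Fin.natAdd h c) :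
        MvPolynomial (Fin (h + h)) (MvPolynomial (Param h) ℂ)) = X (Fin.natAdd h c) := by
    intro c
    rw [killVars_X, if_neg (fun hm => castAdd_ne_natAdd a c (Finset.mem_singleton.mp hm).symm)]
  have hmem : a ∈ univ \ α.1 := Finset.mem_sdiff.mpr ⟨Finset.mem_univ _, ha⟩
  have h2 : killVars {Fin.castAdd h a} (∏ b ∈ α.1, X (Fin.castAdd h b) :
        MvPolynomial (Fin (h + h)) (MvPolynomial (Param h) ℂ)) = ∏ b ∈ α.1, X (Fin.castAdd h b) := by
    rw [map_prod]
    exact Finset.prod_congr rfl (fun b hb => by rw [hX, if_neg (fun hba : b = a => ha (hba ▸ hb))])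
  have h3 : killVars {Fin.castAdd h a} (∏ c ∈ α.2, X (Fin.natAdd h c) :
        MvPolynomial (Fin (h + h)) (MvPolynomial (Param h) ℂ)) = ∏ c ∈ α.2, X (Fin.natAdd h c) := by
    rw [map_prod]
    exact Finset.prod_congr rfl (fun c _ => hY c)
  have h4 : killVars {Fin.castAdd h a}
        (∏ b ∈ univ \ α.1, (1 + C (X (Sum.inr (Sum.inl (α, b)))) * X (Fin.castAdd h b)) :
          MvPolynomial (Fin (h + h)) (MvPolynomial (Param h) ℂ)) =
      ∏ b ∈ (univ \ α.1).erase a, (1 + C (X (Sum.inr (Sum.inl (α, b)))) * X (Fin.castAdd h b)) := by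
    rw [map_prod, ← Finset.mul_prod_erase _ _ hmem, map_add, map_one, map_mul, killVars_C, hX, if_pos rfl,
      mul_zero, add_zero, one_mul]
    exact Finset.prod_congr rfl (fun b hb => by
      rw [map_add, map_one, map_mul, killVars_C, hX, if_neg (Finset.ne_of_mem_erase hb)])
  have h5 : killVars {Fin.castAdd h a}
        (∏ d ∈ univ \ α.2, (1 + C (X (Sum.inr (Sum.inr (α, d)))) * X (Fin.natAdd h d)) :
          MvPolynomial (Fin (h + h)) (MvPolynomial (Param h) ℂ)) =
      ∏ d ∈ univ \ α.2, (1 + C (X (Sum.inr (Sum.inr (α, d)))) * X (Fin.natAdd h d)) := by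
    rw [map_prod]
    exact Finset.prod_congr rfl (fun d _ => by rw [map_add, map_one, map_mul, killVars_C, hY])
  rw [symbFactor, delFactor, map_add, map_one, map_mul, map_mul, map_mul, map_mul, killVars_C, h2, h3, h4, h5]

/-- Killing ALL `x`-variables kills every anchor factor (anchors have nonempty `x`-parts). -/
theorem killVars_allX_symbFactor {s : ℕ} {α : Finset (Fin h) × Finset (Fin h)} (hα : α ∈ anchors s h) :
    killVars (univ.image (Fin.castAdd h)) (symbFactor h α) = 1 := by
  have hA : α.1.Nonempty := by
    rw [anchors, Finset.mem_filter] at hα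
    exact Finset.card_pos.mp (by omega)
  obtain ⟨b, hb⟩ := hA
  exact killVars_symbFactor_of_mem _ α hb (Finset.mem_image_of_mem _ (Finset.mem_univ _))

/-- **The symbolic witness has no non-constant `x`-free monomials**: `[y^W] symbolicWitness s h = [W = ∅]`. -/
theorem coeff_symbolicWitness_xfree (s h : ℕ) (W : Finset (Fin h)) :
    coeff (pexpo ∅ W) (symbolicWitness s h) = if W = ∅ then 1 else 0 := by
  classical
  have hdisj : Disjoint (pexpo (∅ : Finset (Fin h)) W).support (univ.image (Fin.castAdd h)) := by
    rw [Finset.disjoint_left]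
    intro v hv hv'
    obtain ⟨b, -, rfl⟩ := Finset.mem_image.mp hv'
    rw [Finsupp.mem_support_iff, pexpo_apply_castAdd] at hv
    exact hv (if_neg (Finset.notMem_empty b))
  rw [← coeff_killVars_of_disjoint (univ.image (Fin.castAdd h)) _ hdisj, symbolicWitness_eq_prod, map_prod,
    Finset.prod_eq_one (fun α hα => killVars_allX_symbFactor hα)]
  by_cases hW : W = ∅
  · rw [if_pos hW, hW]
    have h0 : pexpo (∅ : Finset (Fin h)) ∅ = 0 := by rw [pexpo_def, Finset.sum_empty, Finset.sum_empty, add_zero]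
    rw [h0, ← constantCoeff_eq, map_one]
  · rw [if_neg hW, ← C_1, coeff_C, if_neg]
    intro h0
    obtain ⟨c, hc⟩ := Finset.nonempty_iff_ne_empty.mpr hW
    have := congrArg (fun m => m (Fin.natAdd h c)) h0
    simp only [pexpo_apply_natAdd, if_pos hc, Finsupp.coe_zero, Pi.zero_apply] at this
    exact zero_ne_one this

/-- Hence the `x_a`-free coefficients of the witness with `x_a` killed: `[y^W] = [W = ∅]` as well. -/
theorem coeff_killVars_symbolicWitness_xfree (s h : ℕ) (a : Fin h) (W : Finset (Fin h)) :
    coeff (pexpo ∅ W) (killVars {Fin.castAdd h a} (symbolicWitness s h)) = if W = ∅ then 1 else 0 := by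
  classical
  rw [coeff_killVars_of_disjoint, coeff_symbolicWitness_xfree]
  rw [Finset.disjoint_singleton_right, Finsupp.mem_support_iff, pexpo_apply_castAdd, not_not,
    if_neg (Finset.notMem_empty a)]

/-- Coefficients at exponents avoiding `x_a` are unchanged by killing `x_a`. -/
theorem coeff_killVars_symbolicWitness_of_not_mem (s h : ℕ) (a : Fin h) {U : Finset (Fin h)} (W : Finset (Fin h))
    (ha : a ∉ U) :
    coeff (pexpo U W) (killVars {Fin.castAdd h a} (symbolicWitness s h)) = coeff (pexpo U W) (symbolicWitness s h) := by
  classical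
  rw [coeff_killVars_of_disjoint]
  rw [Finset.disjoint_singleton_right, Finsupp.mem_support_iff, pexpo_apply_castAdd, not_not, if_neg ha]

/-- Coefficients at exponents containing `x_a` vanish after killing `x_a`. -/
theorem coeff_killVars_symbolicWitness_of_mem (s h : ℕ) (a : Fin h) {U : Finset (Fin h)} (W : Finset (Fin h))
    (ha : a ∈ U) :
    coeff (pexpo U W) (killVars {Fin.castAdd h a} (symbolicWitness s h)) = 0 := by
  classical
  apply coeff_killVars_of_not_disjoint
  rw [Finset.disjoint_singleton_right, Finsupp.mem_support_iff, pexpo_apply_castAdd, not_not, if_pos ha]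
  exact one_ne_zero

end ThinStep

end

end Summit.ValiantsHypothesis.ValiantsHypothesis.Theorems.BarrierLever.AnchoredPeeling
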